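import Mathlib

/-!
# The factor-4 recursion for weighted-Leja ratios (DENSITY-XY G.55): one step, the bound `4^(k-2)`, and the `θ_n` corollary

Kernel anchors for `DENSITY-XY.md` ADDENDUM G.55(b) (repair cell b2b-imbrie, seat 2, XY / free-fermion
rung of the Imbrie programme).  Along the greedy (weighted-Leja) flag of a finitely supported measure,
with first point `y` (the heaviest atom), current pick `p = p_k` and an alive atom `a`, put
`ρ_k(a) := T_k(a) / ((a - y)² · G_k)` where `G_k` is the product weight of `y` inside the picked set.
Then `ρ_{k+1}(a) = ρ_k(a) (a-p)²/(y-p)²` (definition) and, because `p` maximises `T_k`,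
`ρ_{k+1}(a) ≤ ρ_k(p) (a-p)²/(a-y)²`.  With `ρ_k ≤ A` on all alive atoms these two inequalities force
`ρ_{k+1}(a) ≤ 4A` (`leja_ratio_step`): the Leja ratio against the first point can grow by at most a
factor `4` per greedy step, hence is `≤ 4^(k-2)` at step `k` (`recursion_bound_four_pow`), and the last
ratio `θ_n = Σ_{i ≤ n} û_n / U_n(p_i) ≤ 1 + Σ_{j < n-1} 4^j = (4^(n-1) + 2)/3` (`theta_last_le`).
G.55(c) shows by an exact rational family that exponential growth does occur (`L_n ≥ e^{0.41 n}`), which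
refutes the conjectured bounds `L ≤ const`, `θ_k ≤ C n` of G.54(c); the recursion here is what survives.

Elementary real analysis only; the combinatorial bookkeeping (finite configurations, argmax, the
restriction argument for a general reference point) stays on paper in G.55(b).  Nothing here asserts
CONJECTURE U or anything about the interacting chain.
-/

namespace Literature.MathematicalPhysics.QuantumLattice.Imbrie2016

/-- `(a - p)² ≤ (|a - y| + |y - p|)²`: the squared jump is controlled through any third point.
[folklore] -/
theorem sq_sub_le_sq_abs_add (a p y : ℝ) : (a - p) ^ 2 ≤ (|a - y| + |y - p|) ^ 2 := by
  have h : |a - p| ≤ |a - y| + |y - p| := abs_sub_le a y p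
  have h0 : 0 ≤ |a - p| := abs_nonneg _
  have h2 : |a - p| * |a - p| ≤ (|a - y| + |y - p|) * (|a - y| + |y - p|) :=
    mul_self_le_mul_self h0 h
  rw [pow_two, pow_two, ← abs_mul_abs_self (a - p)]
  exact h2

/-- **One step of the Leja-ratio recursion (G.55(b)).**  If the normalised ratios of an alive atom `a`
and of the current pick `p` (both relative to the first point `y`) are at most `A`, then the two greedy
consequences `ρ' ≤ ρa (a-p)²/(y-p)²` and `ρ' ≤ ρp (a-p)²/(a-y)²` give `ρ' ≤ 4 A`.  Proof: with
`s = |a-y|`, `t = |y-p|`, `(a-p)² ≤ (s+t)² ≤ 4 max(s,t)²`; use the first inequality if `s ≤ t`, the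
second otherwise.  [folklore] -/
theorem leja_ratio_step (ρ' ρa ρp A a p y : ℝ) (hay : a ≠ y) (hpy : p ≠ y)
    (hρa : 0 ≤ ρa) (hρp : 0 ≤ ρp) (haA : ρa ≤ A) (hpA : ρp ≤ A)
    (h1 : ρ' ≤ ρa * (a - p) ^ 2 / (y - p) ^ 2) (h2 : ρ' ≤ ρp * (a - p) ^ 2 / (a - y) ^ 2) :
    ρ' ≤ 4 * A := by
  have hA : 0 ≤ A := le_trans hρa haA
  have hs : 0 < |a - y| := abs_pos.mpr (sub_ne_zero.mpr hay)
  have ht : 0 < |y - p| := abs_pos.mpr (sub_ne_zero.mpr (Ne.symm hpy))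
  have hsq : (a - p) ^ 2 ≤ (|a - y| + |y - p|) ^ 2 := sq_sub_le_sq_abs_add a p y
  have hs2 : (a - y) ^ 2 = |a - y| ^ 2 := (sq_abs _).symm
  have ht2 : (y - p) ^ 2 = |y - p| ^ 2 := (sq_abs _).symm
  rcases le_total |a - y| |y - p| with hst | hts
  · -- s ≤ t: (s+t)² ≤ 4t², use h1
    have hb : (|a - y| + |y - p|) ^ 2 ≤ 4 * |y - p| ^ 2 := by nlinarith
    have key : ρa * (a - p) ^ 2 ≤ 4 * A * |y - p| ^ 2 :=
      calc ρa * (a - p) ^ 2 ≤ ρa * (|a - y| + |y - p|) ^ 2 := mul_le_mul_of_nonneg_left hsq hρa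
        _ ≤ A * (4 * |y - p| ^ 2) := mul_le_mul haA hb (sq_nonneg _) hA
        _ = 4 * A * |y - p| ^ 2 := by ring
    have ht2pos : 0 < |y - p| ^ 2 := by positivity
    rw [ht2] at h1
    calc ρ' ≤ ρa * (a - p) ^ 2 / |y - p| ^ 2 := h1
      _ ≤ 4 * A * |y - p| ^ 2 / |y - p| ^ 2 := by gcongr
      _ = 4 * A := by rw [mul_div_assoc, div_self (ne_of_gt ht2pos), mul_one]
  · -- t ≤ s: (s+t)² ≤ 4s², use h2
    have hb : (|a - y| + |y - p|) ^ 2 ≤ 4 * |a - y| ^ 2 := by nlinarith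
    have key : ρp * (a - p) ^ 2 ≤ 4 * A * |a - y| ^ 2 :=
      calc ρp * (a - p) ^ 2 ≤ ρp * (|a - y| + |y - p|) ^ 2 := mul_le_mul_of_nonneg_left hsq hρp
        _ ≤ A * (4 * |a - y| ^ 2) := mul_le_mul hpA hb (sq_nonneg _) hA
        _ = 4 * A * |a - y| ^ 2 := by ring
    have hs2pos : 0 < |a - y| ^ 2 := by positivity
    rw [hs2] at h2
    calc ρ' ≤ ρp * (a - p) ^ 2 / |a - y| ^ 2 := h2
      _ ≤ 4 * A * |a - y| ^ 2 / |a - y| ^ 2 := by gcongr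
      _ = 4 * A := by rw [mul_div_assoc, div_self (ne_of_gt hs2pos), mul_one]

/-- **The growth bound.**  A sequence with `A 2 ≤ 1` and `A (k+1) ≤ 4 · A k` for `k ≥ 2` satisfies
`A k ≤ 4^(k-2)` for all `k ≥ 2` (the Leja ratio against the first point after `k` greedy steps;
G.55(b) COROLLARY 1).  [folklore] -/
theorem recursion_bound_four_pow (A : ℕ → ℝ) (h2 : A 2 ≤ 1)
    (hstep : ∀ k, 2 ≤ k → A (k + 1) ≤ 4 * A k) :
    ∀ k, 2 ≤ k → A k ≤ 4 ^ (k - 2) := by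
  intro k hk
  induction k, hk using Nat.le_induction with
  | base => simpa using h2
  | succ m hm ih =>
      calc A (m + 1) ≤ 4 * A m := hstep m hm
        _ ≤ 4 * 4 ^ (m - 2) := by linarith
        _ = 4 ^ (m + 1 - 2) := by
            rw [show m + 1 - 2 = (m - 2) + 1 by omega, pow_succ]; ring

/-- **The last-step ratio `θ_n` (G.55(b) COROLLARY 2).**  `θ_n = Σ_{i=1}^{n} û_n / U_n(p_i)` with the
`i = n` term equal to `1` and the term of the reference point `p_i`, `i < n`, bounded by `4^(n-1-i)`
(COROLLARY 1 applied to the system alive at time `i`); re-indexing `j = n-1-i` the bound is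
`1 + Σ_{j < n-1} 4^j = 1 + (4^(n-1) - 1)/3`.  [folklore] -/
theorem theta_last_le (n : ℕ) (r : ℕ → ℝ) (hr : ∀ j, j < n - 1 → r j ≤ 4 ^ j) :
    1 + ∑ j ∈ Finset.range (n - 1), r j ≤ 1 + ((4 : ℝ) ^ (n - 1) - 1) / 3 := by
  have hsum : ∑ j ∈ Finset.range (n - 1), r j ≤ ∑ j ∈ Finset.range (n - 1), (4 : ℝ) ^ j :=
    Finset.sum_le_sum fun j hj => hr j (Finset.mem_range.mp hj)
  have hgeom : ∑ j ∈ Finset.range (n - 1), (4 : ℝ) ^ j = ((4 : ℝ) ^ (n - 1) - 1) / 3 := by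
    rw [geom_sum_eq (by norm_num : (4 : ℝ) ≠ 1)]; norm_num
  linarith

end Literature.MathematicalPhysics.QuantumLattice.Imbrie2016
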